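import Summits.QuantumFields.BalabanUV.T4Continuum.Support.DecayRateInterpolation
import Summits.QuantumFields.BalabanUV.T4Continuum.Support.ScalarBlockPlanting
import Summits.QuantumFields.BalabanUV.T4Continuum.Spine.NE2ColourPerturbedLayer

/-!
# T⁴ programme, spine node NE2 (U1a), sub-row Δ3 «NE2-WALK» — THE BLOCK-SUM DICTIONARY: the entries of the unit-lattice images
# `avgTow A r X k` ARE block sums of the fine kernel, so the uniform-decay binder `hdec` of `Spine/NE2BalabanDecayRate` is implied by
# a BLOCK-ℓ¹ DECAY of the fine propagators — the printed KIND of [B5] (1.90) / [B9] Thm 3.4, read entrywise on the fine lattice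

Eleventh generation of the NE2 prover lineage P1 of the cell `pub-balaban` (row NE2 owner), file 6 (owner row «Δ3-BLOCKSUM» of ruling R20;
companion of `Support/DecayRateInterpolation` p218010/p218145 and `Spine/NE2BalabanDecayRate` p218845).  Those files convert the landed
operator-norm rate into King's (4.38) decay shape MODULO one displayed binder `hdec : ∀ k, EntryDecay dist (c_k) B δ` on the UNIT-LATTICE IMAGES
`c_k = r^k·A^{(k)}X_kA^{(k)ᴴ}`.  The audited series prints decay for the FINE propagators themselves ([Balaban1984PropagatorsI] (1.90) p. 33:
`|G_k(x,x′)| ≤ …e^{−δ|x−x′|}` in unit distance; [Balaban1985BackgroundPropagators] Thm 3.4 p. 400).  This file supplies the elementary dictionary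
between the two:

 * §1 for ANY averaging family with INDICATOR STRUCTURE `A k i u = r⁻¹·[prt k u = i]` (a level-`(k+1)` site `u` is averaged into its parent
   `prt k u` with weight `r⁻¹` — King's `Q_L` has `r = L^d`), the composite `Atow A k` has entries `r^{−k}·[prtk k u = x]` (`prtk` = iterated
   parent = the unit block of `u`; `Atow_apply_of_indicator`), hence **`avgTow_apply_eq_blockSum`**:
   `(avgTow A r X k)(x,y) = r^{−k}·Σ_{u : prtk u = x} Σ_{v : prtk v = y} X_k(u,v)` and **`norm_avgTow_apply_le_blockSum`**;
 * §2 the hypothesis shape **`BlockL1Decay prt r dist X B δ`**: `Σ_{u ∈ B_k(x)} Σ_{v ∈ B_k(y)} ‖X_k(u,v)‖ ≤ B·r^k·e^{−δ·dist(x,y)}` (block-ℓ¹ mass of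
   the fine kernel between two unit blocks — what an entrywise bound `|X_k(u,v)| ≤ C·r^{−k}·e^{−δ|…|}` with an integrable near-diagonal
   singularity sums to), and **`entryDecay_avgTow_of_blockL1`**: `BlockL1Decay … ⟹ ∀ k, EntryDecay dist (avgTow A r X k) B δ` — i.e. `hdec`;
 * §3 the two instances of the cell: King's `Qlev L M k` (`prt k u = (par u.1, u.2)`, `Qlev_indicator`) and its colour lift `Qlev L M k ⊗ₖ 1`
   (`prt k (u, b) = ((par u.1, u.2), b)`, `QlevKron_indicator`); hence **`hdec_pertCovC_of_blockL1`**: a block-ℓ¹ decay of the lifted perturbed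
   fine propagators `(Δ_a^{(k)}⊗1 + tP_k)⁻¹` gives the binder `hdec` of `NE2BalabanDecayRate.decayStations_pertCovC(_rate)` /
   `balaban_final_decayStations_of_regular` verbatim.

HONEST FRAMING (T4-DAG p. 1).  [folklore] bookkeeping (finite sums, triangle inequality); statements OURS; `BlockL1Decay` is a HYPOTHESIS
SHAPE — the printed KIND of bound on Bałaban's fine propagators, asserted by nobody here (at `U ≠ 1` it is read on Bałaban's carriers, B0; at
`U = 1` the n-uniform torus decay of the free fine kernel is the crew's item «Δ3-U1-IMAGESUM», leaf-06-g2, plus the `η^d`-normalisation dictionary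
GAPS G-ne2p2-9 (β)); NE2 (U1a) NOT proved; spine 0/9 unchanged; NOT infinite volume, NOT a mass gap, NOT the Clay problem, NOT summit progress.
HONEST DEPENDENCY: continuum YM on T⁴ ⇐ BetaPertH ∧ nine spine estimates (0/9 proved); BetaPertH ⇐ (D1) ∧ (D4) ∧ CAP+tail; G-an2-4 gates asym,
D1 and NE2/3/4.  No `sorry`.
-/

noncomputable section

open scoped BigOperators ComplexConjugate Matrix Matrix.Norms.L2Operator Kronecker
open Finset

namespace Summit.QuantumFields.BalabanUV.T4Continuum.BlockSumDecay

open Literature.MathematicalPhysics.QuantumFieldTheory.Balaban1983to89.B5Prop11Plancherel (Tor fine)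
open Literature.MathematicalPhysics.QuantumFieldTheory.Balaban1983to89.B5G183RateTorusW (Qavg)
open Literature.MathematicalPhysics.QuantumFieldTheory.Balaban1983to89.B5G183RateUnitTower (lev lev_neZero)
open Summit.QuantumFields.BalabanUV.T4Continuum
open Summit.QuantumFields.BalabanUV.T4Continuum.CovariantAveragingTower (Atow Atow_zero Atow_succ avgTow)
open Summit.QuantumFields.BalabanUV.T4Continuum.BalabanAveragedTowerUnit (idx Qlev)
open Summit.QuantumFields.BalabanUV.T4Continuum.BalabanAveragedTowerModes (par)
open Summit.QuantumFields.BalabanUV.T4Continuum.ScalarBlockPlanting (Qavg_apply)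
open Summit.QuantumFields.BalabanUV.T4Continuum.DecayRateInterpolation (EntryDecay)
open Summit.QuantumFields.BalabanUV.T4Continuum.KingPairingPlantedLaw (calDalev)
open Summit.QuantumFields.BalabanUV.T4Continuum.NE2ColourPerturbedLayer (pertCovC)

/-! ## §1 Averaging families with indicator structure: the composite averaging is a block indicator -/

section Indicator

variable {ι : ℕ → Type*} [∀ k, Fintype (ι k)] [∀ k, DecidableEq (ι k)]

/-- the ITERATED PARENT (the unit block of a level-`k` site): `prtk 0 = id`, `prtk (k+1) u = prtk k (prt k u)`. [folklore] -/
def prtk (prt : (k : ℕ) → ι (k + 1) → ι k) : (k : ℕ) → ι k → ι 0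
  | 0 => id
  | k + 1 => fun u => prtk prt k (prt k u)

variable {A : (k : ℕ) → Matrix (ι k) (ι (k + 1)) ℂ} {prt : (k : ℕ) → ι (k + 1) → ι k} {r : ℝ}

/-- **the composite of indicator averagings is a block indicator**: `(Atow A k) x u = r^{−k}·[prtk k u = x]`. [folklore] -/
theorem Atow_apply_of_indicator (hA : ∀ k i u, A k i u = if prt k u = i then ((r : ℂ))⁻¹ else 0) :
    ∀ (k : ℕ) (x : ι 0) (u : ι k), Atow A k x u = if prtk prt k u = x then (((r : ℂ))⁻¹) ^ k else 0
  | 0, x, u => by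
      simp only [Atow_zero, Matrix.one_apply, prtk, id_eq, pow_zero]
      by_cases h : x = u
      · rw [if_pos h, if_pos h.symm]
      · rw [if_neg h, if_neg (Ne.symm h)]
  | k + 1, x, u => by
      rw [Atow_succ, Matrix.mul_apply]
      have e : ∀ w : ι k, Atow A k x w * A k w u
          = if w = prt k u then (if prtk prt k (prt k u) = x then (((r : ℂ))⁻¹) ^ (k + 1) else 0) else 0 := by
        intro w
        rw [hA k w u, Atow_apply_of_indicator hA k x w]
        by_cases hw : w = prt k u
        · subst hw
          rw [if_pos rfl, if_pos rfl]
          by_cases hx : prtk prt k (prt k u) = x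
          · rw [if_pos hx, if_pos hx, pow_succ]
          · rw [if_neg hx, if_neg hx, zero_mul]
        · rw [if_neg (Ne.symm hw), if_neg hw, mul_zero]
      rw [Finset.sum_congr rfl (fun w _ => e w), Finset.sum_ite_eq' Finset.univ (prt k u)]
      simp only [Finset.mem_univ, if_true]
      rfl

/-- **THE ENTRIES OF THE UNIT-LATTICE IMAGE ARE BLOCK SUMS**: `(avgTow A r X k)(x,y) = r^{−k}·Σ_{u : prtk u = x} Σ_{v : prtk v = y} X_k(u,v)`
(`r ≠ 0`). [folklore] -/
theorem avgTow_apply_eq_blockSum (hA : ∀ k i u, A k i u = if prt k u = i then ((r : ℂ))⁻¹ else 0) (hr : r ≠ 0)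
    (X : (k : ℕ) → Matrix (ι k) (ι k) ℂ) (k : ℕ) (x y : ι 0) :
    avgTow A r X k x y = (((r : ℂ)) ^ k)⁻¹ *
      ∑ u ∈ Finset.univ.filter (fun u => prtk prt k u = x), ∑ v ∈ Finset.univ.filter (fun v => prtk prt k v = y), X k u v := by
  have hrC : ((r : ℂ)) ≠ 0 := by exact_mod_cast hr
  set c : ℂ := (((r : ℂ))⁻¹) ^ k with hc
  have hcs : star c = c := by rw [hc, star_pow, star_inv₀, Complex.star_def, Complex.conj_ofReal]
  have hAt : ∀ (z : ι 0) (w : ι k), Atow A k z w = if prtk prt k w = z then c else 0 := fun z w => Atow_apply_of_indicator hA k z w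
  have e1 : (Atow A k * X k * (Atow A k)ᴴ) x y = ∑ v, (∑ u, Atow A k x u * X k u v) * star (Atow A k y v) := by
    simp only [Matrix.mul_apply, Matrix.conjTranspose_apply]
  have e2 : ∀ v, (∑ u, Atow A k x u * X k u v) = c * ∑ u ∈ Finset.univ.filter (fun u => prtk prt k u = x), X k u v := by
    intro v
    rw [Finset.sum_filter, Finset.mul_sum]
    refine Finset.sum_congr rfl fun u _ => ?_
    rw [hAt]
    by_cases hu : prtk prt k u = x
    · rw [if_pos hu, if_pos hu]
    · rw [if_neg hu, if_neg hu, zero_mul, mul_zero]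
  have e3 : ∀ v, star (Atow A k y v) = if prtk prt k v = y then c else 0 := by
    intro v; rw [hAt]
    by_cases hv : prtk prt k v = y
    · rw [if_pos hv, hcs]
    · rw [if_neg hv, star_zero]
  have hcc : ((r : ℂ)) ^ k * (c * c) = (((r : ℂ)) ^ k)⁻¹ := by
    rw [hc, inv_pow, ← mul_assoc, mul_inv_cancel₀ (pow_ne_zero _ hrC), one_mul]
  rw [avgTow, Matrix.smul_apply, smul_eq_mul, e1]
  simp_rw [e2, e3, mul_ite, mul_zero]
  rw [← Finset.sum_filter, Finset.mul_sum]
  have e4 : ∀ v, ((r : ℂ)) ^ k * (c * (∑ u ∈ Finset.univ.filter (fun u => prtk prt k u = x), X k u v) * c)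
      = (((r : ℂ)) ^ k)⁻¹ * ∑ u ∈ Finset.univ.filter (fun u => prtk prt k u = x), X k u v := by
    intro v; rw [← hcc]; ring
  rw [Finset.sum_congr rfl (fun v _ => e4 v), ← Finset.mul_sum, Finset.sum_comm]

/-- **hence the entries are bounded by the block-ℓ¹ mass**: `‖(avgTow A r X k)(x,y)‖ ≤ r^{−k}·Σ_{u ∈ B_k(x)} Σ_{v ∈ B_k(y)} ‖X_k(u,v)‖` (`r > 0`).
[folklore] -/
theorem norm_avgTow_apply_le_blockSum (hA : ∀ k i u, A k i u = if prt k u = i then ((r : ℂ))⁻¹ else 0) (hr : 0 < r)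
    (X : (k : ℕ) → Matrix (ι k) (ι k) ℂ) (k : ℕ) (x y : ι 0) :
    ‖avgTow A r X k x y‖ ≤ (r ^ k)⁻¹ *
      ∑ u ∈ Finset.univ.filter (fun u => prtk prt k u = x), ∑ v ∈ Finset.univ.filter (fun v => prtk prt k v = y), ‖X k u v‖ := by
  rw [avgTow_apply_eq_blockSum hA hr.ne' X k x y, norm_mul, norm_inv, norm_pow, Complex.norm_real, Real.norm_of_nonneg hr.le]
  refine mul_le_mul_of_nonneg_left ?_ (inv_nonneg.mpr (pow_nonneg hr.le k))
  refine (norm_sum_le _ _).trans (Finset.sum_le_sum fun u _ => norm_sum_le _ _)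

/-! ## §2 Block-ℓ¹ decay of the fine kernel gives the uniform entry decay `hdec` of the unit-lattice images -/

/-- **BLOCK-ℓ¹ DECAY** of a tower of fine kernels between unit blocks: `Σ_{u ∈ B_k(x)} Σ_{v ∈ B_k(y)} ‖X_k(u,v)‖ ≤ B·r^k·e^{−δ·dist(x,y)}` for all
`k, x, y` — the printed KIND of bound ([B5] (1.90), [B9] Thm 3.4: exponential decay of the fine propagators in unit distance) summed over two
unit blocks; a HYPOTHESIS SHAPE, asserted by nobody. [cite: Balaban1984PropagatorsI, Prop. 1.1 (1.90) p.33 (the printed kind)] [folklore] -/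
def BlockL1Decay (prt : (k : ℕ) → ι (k + 1) → ι k) (r : ℝ) (dist : ι 0 → ι 0 → ℝ) (X : (k : ℕ) → Matrix (ι k) (ι k) ℂ)
    (B δ : ℝ) : Prop :=
  ∀ (k : ℕ) (x y : ι 0),
    ∑ u ∈ Finset.univ.filter (fun u => prtk prt k u = x), ∑ v ∈ Finset.univ.filter (fun v => prtk prt k v = y), ‖X k u v‖
      ≤ B * r ^ k * Real.exp (-(δ * dist x y))

/-- **`hdec` FROM BLOCK-ℓ¹ DECAY**: for an averaging family with indicator structure and `r > 0`,
`BlockL1Decay prt r dist X B δ ⟹ ∀ k, EntryDecay dist (avgTow A r X k) B δ`. [folklore] -/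
theorem entryDecay_avgTow_of_blockL1 (hA : ∀ k i u, A k i u = if prt k u = i then ((r : ℂ))⁻¹ else 0) (hr : 0 < r)
    {dist : ι 0 → ι 0 → ℝ} {X : (k : ℕ) → Matrix (ι k) (ι k) ℂ} {B δ : ℝ} (h : BlockL1Decay prt r dist X B δ) (k : ℕ) :
    EntryDecay dist (avgTow A r X k) B δ := by
  intro x y
  refine (norm_avgTow_apply_le_blockSum hA hr X k x y).trans ?_
  have hrk : 0 < r ^ k := pow_pos hr k
  calc (r ^ k)⁻¹ * _ ≤ (r ^ k)⁻¹ * (B * r ^ k * Real.exp (-(δ * dist x y))) := mul_le_mul_of_nonneg_left (h k x y) (inv_nonneg.mpr hrk.le)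
    _ = B * Real.exp (-(δ * dist x y)) := by field_simp

end Indicator

/-! ## §3 The cell's instances: King's `Q_L` and its colour lift -/

section King

variable {d : ℕ} (L : ℕ) [NeZero L] (M : Fin d → ℕ) [hM : ∀ μ, NeZero (M μ)]

/-- the one-step parent of King's averaging along the tower: `(par, component)`. [folklore] -/
def prtQ (k : ℕ) (u : idx L M (k + 1)) : idx L M k := (par (lev L k) L M u.1, u.2)

/-- **King's `Q_L` has indicator structure** with `r = L^d`. [cite: King1986, (2.10) p.653] [folklore] -/
theorem Qlev_indicator (k : ℕ) (i : idx L M k) (u : idx L M (k + 1)) :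
    Qlev L M k i u = if prtQ L M k u = i then ((((L : ℝ) ^ d : ℝ) : ℂ))⁻¹ else 0 := by
  rw [show Qlev L M k i u = Qavg (lev L k) L M i u from rfl, Qavg_apply]
  push_cast
  rfl

variable (o : Type*) [Fintype o] [DecidableEq o]

/-- the one-step parent of the colour-lifted averaging: `((par, component), colour)`. [folklore] -/
def prtQK (k : ℕ) (u : idx L M (k + 1) × o) : idx L M k × o := (prtQ L M k u.1, u.2)

omit [Fintype o] in
/-- **the colour lift `Q_L ⊗ 1` has indicator structure** with `r = L^d`. [folklore] -/
theorem QlevKron_indicator (k : ℕ) (i : idx L M k × o) (u : idx L M (k + 1) × o) :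
    (Qlev L M k ⊗ₖ (1 : Matrix o o ℂ)) i u = if prtQK L M o k u = i then ((((L : ℝ) ^ d : ℝ) : ℂ))⁻¹ else 0 := by
  rw [Matrix.kroneckerMap_apply, Qlev_indicator, Matrix.one_apply]
  have hiff : prtQK L M o k u = i ↔ prtQ L M k u.1 = i.1 ∧ u.2 = i.2 := by
    constructor
    · intro h; rw [← h]; exact ⟨rfl, rfl⟩
    · rintro ⟨h1, h2⟩; exact Prod.ext h1 h2
  by_cases h1 : prtQ L M k u.1 = i.1
  · by_cases h2 : u.2 = i.2
    · rw [if_pos h1, if_pos h2.symm, mul_one, if_pos (hiff.mpr ⟨h1, h2⟩)]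
    · rw [if_pos h1, if_neg (fun h => h2 h.symm), mul_zero, if_neg (fun h => h2 (hiff.mp h).2)]
  · rw [if_neg h1, zero_mul, if_neg (fun h => h1 (hiff.mp h).1)]

variable (a : ℝ) (ha : 0 < a)

/-- **`hdec` OF THE COLOUR TOWER FROM BLOCK-ℓ¹ DECAY OF THE FINE PERTURBED PROPAGATORS**: if the lifted perturbed fine propagators
`(Δ_a^{(k)}⊗1 + tP_k)⁻¹` have block-ℓ¹ decay `(B, δ)` against `dist`, the unit-lattice images `pertCovC P t k` have the level-uniform entry decay
`(B, δ)` — exactly the binder `hdec` of `NE2BalabanDecayRate.decayStations_pertCovC(_rate)` / `balaban_final_decayStations_of_regular`.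
[cite: Balaban1985BackgroundPropagators, Thm 3.4 p.400 (the printed kind of the input)] [folklore] -/
theorem hdec_pertCovC_of_blockL1 {P : (k : ℕ) → Matrix (idx L M k × o) (idx L M k × o) ℂ} {t : ℂ}
    {dist : idx L M 0 × o → idx L M 0 × o → ℝ} {B δ : ℝ}
    (h : BlockL1Decay (prtQK L M o) ((L : ℝ) ^ d) dist
      (fun k => (calDalev L M a ha k ⊗ₖ (1 : Matrix o o ℂ) + t • P k)⁻¹) B δ) (k : ℕ) :
    EntryDecay dist (pertCovC L M a ha P t k) B δ :=
  entryDecay_avgTow_of_blockL1 (QlevKron_indicator L M o) (pow_pos (by exact_mod_cast Nat.pos_of_ne_zero (NeZero.ne L)) d) h k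

end King

end Summit.QuantumFields.BalabanUV.T4Continuum.BlockSumDecay

end
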